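import Summits.ResolutionOfSingularities.ResolutionOfSingularities.Theorems.FrobeniusClosingPatchingRelPerfectConeDepthSmoothConeFibre
import Summits.ResolutionOfSingularities.ResolutionOfSingularities.Theorems.FrobeniusClosingPatchingRelPerfectConeDepthLadderStep
import Literature.RingTheory.HilbertSamuel.PhiLowerBound
import HarnessLib

/-!
# Crux `PatchingRelPerfect` (stmt-ResolutionOfSingularities-16161), chain W5.2 — rung «r-smooth-cone-ℓ», LADDER: the state of the
# vertex-blowup ladder for the cone over a SMOOTH PLANE CURVE of degree `d`, and one rung (blowing up the vertex, weight `d`)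

[OURS · L1 W5.2 · rung tool] Replaces the role of NO printed item; NOT a statement of the manuscript under review; fact-free,
any characteristic, any residue field, any degree `d ≥ 2`.  AI-written (AI review is weaker than expert review).

`ConeDepth.SmoothConeState d I X g M 𝓗 E A B a b z` is g4's `LadderState` with the quadric cone replaced by the cone
`N(c₁, c₂, c₃)` over a smooth plane curve of degree `d` (a form `N` over `𝒪_{X,z}` with the certificates (HV), (HC) of
`…SmoothConeCharts`): `X` integral Noetherian regular over `Spec S` by a closed-point blowing up `g`, THE FORMAT
`I𝒪_X = M · (𝓗 · mono(A ++ [(E,a)]) ⊔ mono(B ++ [(E,b)]))`, the vertex `z` (closed, over the closed point, `𝒪_{X,z}` regular of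
dimension `4`, `E_z = (c₀)`, the other carriers missing `z`) and simple normal crossings of `𝓗 :: carriers` off `z`.  PROVED:
`conclusion_of_zero` (the END at `b = 0`, verbatim from the cone ladder) and **`step`**: blowing up the vertex with the SMOOTH-CONE
VERTEX FIBRE THEOREM (`smoothCone_vertex_fibre`) yields a state on `X'` at the new vertex with `M' = σ^*M · 𝓘_{E'}^m`,
`m = min (a + d) b`, exponents `(a + d - m, b - m)` — `σ^*𝓗 = 𝓘_{E'}^d · σᶜ(𝓗, d)` as `𝓗_z ⊆ 𝔪_z^d`.

## References
* J. Kollár, *Lectures on Resolution of Singularities* (2007), 3.61, (3.111) Step 3. [Kollar2007]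
* Q. Liu, *Algebraic Geometry and Arithmetic Curves*, OUP 2002, Thm. 8.1.19 (a). [Liu2002]
* The Stacks Project, Tags 080A, 080B. [StacksProject]
* H. Matsumura, *Commutative Ring Theory*, CUP 1986, Thm. 2.3, §14. [Matsumura1987]
-/

set_option linter.dupNamespace false

noncomputable section

open CategoryTheory CategoryTheory.Limits AlgebraicGeometry TopologicalSpace IsLocalRing
open Literature.AlgebraicGeometry.Resolution
open Scheme.IdealSheafData
open scoped Pointwise

namespace Summit.ResolutionOfSingularities.ResolutionOfSingularities.Theorems

universe u

namespace ConeDepth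

/-! ## §4' The state of the ladder for the cone over a smooth plane curve -/

/-- **State of the vertex-blowup ladder, smooth-cone version** [OURS · L1 W5.2 · rung tool; cf. Kollár (3.111) Step 3]: as
`LadderState`, with the vertex clause reading the host as the cone `(N(c₁,c₂,c₃))` over a smooth plane curve of degree `d ≥ 2`
(`N` a form of degree `d` over `𝒪_{X,z}` with the certificates (HV) `(T₁,T₂,T₃)^m ≤ (F₀, ∂F₀)` and (HC) `(F_i, ∂F_i) = (1)`,
`i ≠ 0`, on the reduced chart polynomials of `N(T₁,T₂,T₃)`) and the carrier as `(c₀)`. [cite: Kollar2007, (3.111) Step 3 and 3.61] -/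
structure SmoothConeState {S : Type u} [CommRing S] [IsRegularLocalRing S] (deg : ℕ) (I : Ideal S) (X : Scheme.{u})
    (g : X ⟶ Spec (.of S)) (M 𝓗 E : X.IdealSheafData) (A B : List (X.IdealSheafData × ℕ)) (a b : ℕ) (z : X) :
    Prop where
  /-- the degree is at least two -/
  two_le : 2 ≤ deg
  /-- `X` is integral -/
  isIntegral : IsIntegral X
  /-- `X` is Noetherian -/
  isNoetherian : IsNoetherian X
  /-- `X` is regular -/
  isRegular : Scheme.IsRegular X
  /-- `g` is a blowing up along an ideal sheaf cosupported in the closed point -/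
  exists_isBlowup : ∃ K₀ : (Spec (.of S)).IdealSheafData, IsBlowup g K₀ ∧
    (K₀.support : Set (Spec (.of S))) ⊆ {IsLocalRing.closedPoint S}
  /-- the invertible factor is locally principal -/
  isLocallyPrincipal : IsLocallyPrincipal M
  /-- the two exponent lists live on the same boundary -/
  boundaryOf_eq : boundaryOf A = boundaryOf B
  /-- THE FORMAT -/
  format : (affineBlowup.idealSheaf I).comap g =
    M * (𝓗 * monomialIdeal (A ++ [(E, a)]) ⊔ monomialIdeal (B ++ [(E, b)]))
  /-- the vertex is a closed point … -/
  isClosed : IsClosed ({z} : Set X)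
  /-- … over the closed point -/
  apply_eq : g z = IsLocalRing.closedPoint S
  /-- at the vertex: a regular system of parameters reading the cone over a smooth plane curve and the carrier -/
  vertex : ∃ c : Fin 4 → X.presheaf.stalk z, IsRegularLocalRing (X.presheaf.stalk z) ∧
    Ideal.span (Set.range c) = maximalIdeal (X.presheaf.stalk z) ∧ (maximalIdeal (X.presheaf.stalk z)).spanFinrank = 4 ∧
    (∃ N : MvPolynomial (Fin 3) (X.presheaf.stalk z), N.IsHomogeneous deg ∧
      (∃ m : ℕ, Ideal.span (Set.range (MvPolynomial.X : {j : Fin 4 // j ≠ (0 : Fin 4)} → _)) ^ m ≤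
        Ideal.span (insert (chartPoly (MvPolynomial.rename Fin.succ N) 0)
          (Set.range fun t => MvPolynomial.pderiv t (chartPoly (MvPolynomial.rename Fin.succ N) 0)))) ∧
      (∀ i : Fin 4, i ≠ 0 → Ideal.span (insert (chartPoly (MvPolynomial.rename Fin.succ N) i)
        (Set.range fun t => MvPolynomial.pderiv t (chartPoly (MvPolynomial.rename Fin.succ N) i))) = ⊤) ∧
      stalkIdeal 𝓗 z = Ideal.span {MvPolynomial.eval (fun k : Fin 3 => c k.succ) N}) ∧
    stalkIdeal E z = Ideal.span {c 0}
  /-- the other carriers miss the vertex -/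
  not_mem_support : ∀ D ∈ boundaryOf A, z ∉ D.support
  /-- simple normal crossings over the closed point, off the vertex -/
  snc : ∀ x : X, g x = IsLocalRing.closedPoint S → x ≠ z → DepthSNC.SNCWithAt (𝓗 :: (boundaryOf A ++ [E])) ⊤ x

namespace SmoothConeState

variable {S : Type u} [CommRing S] [IsRegularLocalRing S] {deg : ℕ} {I : Ideal S} {X : Scheme.{u}} {g : X ⟶ Spec (.of S)}
  {M 𝓗 E : X.IdealSheafData} {A B : List (X.IdealSheafData × ℕ)} {a b : ℕ} {z : X}

/-- The host stalk lies in `𝔪_z^d` (a form of degree `d` in the regular system of parameters). [cite: Matsumura1987, §14] -/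
theorem stalkIdeal_host_le_pow (h : SmoothConeState deg I X g M 𝓗 E A B a b z) :
    stalkIdeal 𝓗 z ≤ maximalIdeal (X.presheaf.stalk z) ^ deg := by
  obtain ⟨c, hreg, hc, hd, ⟨N, hN, -, -, h𝓗⟩, -⟩ := h.vertex
  rw [h𝓗, Ideal.span_singleton_le_iff_mem, show MvPolynomial.eval (fun k : Fin 3 => c k.succ) N =
    MvPolynomial.eval c (MvPolynomial.rename Fin.succ N) from (MvPolynomial.eval_rename Fin.succ c N).symm]
  exact Literature.RingTheory.HilbertSamuel.eval_mem_pow_of_isHomogeneous c hc hN.rename_isHomogeneous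

/-- The cone and the carrier through the vertex are different ideal sheaves (`c₀ ∉ 𝔪_z²` while the host lies in `𝔪_z^d ⊆ 𝔪_z²`).
[cite: Matsumura1987, Thm. 2.3 and §14] -/
theorem host_ne_carrier (h : SmoothConeState deg I X g M 𝓗 E A B a b z) : 𝓗 ≠ E := by
  have hle := h.stalkIdeal_host_le_pow
  obtain ⟨c, hreg, hc, hd, -, hE⟩ := h.vertex
  intro heq
  have h0 : c 0 ∈ maximalIdeal (X.presheaf.stalk z) ^ 2 := by
    refine Ideal.pow_le_pow_right h.two_le (hle ?_)
    rw [heq, hE]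
    exact Ideal.mem_span_singleton_self _
  exact Literature.AlgebraicGeometry.Hironaka2017.S06BaseHike.not_mem_maximalIdeal_sq_of_minimal_generators hc hd 0 h0

/-- The vertex lies on the cone. [folklore] -/
theorem mem_support_host (h : SmoothConeState deg I X g M 𝓗 E A B a b z) : z ∈ 𝓗.support := by
  have hle := h.stalkIdeal_host_le_pow
  obtain ⟨c, hreg, hc, hd, -, -⟩ := h.vertex
  rw [mem_support_iff_stalkIdeal_le]
  exact hle.trans (Ideal.pow_le_self (by have := h.two_le; omega))

/-- The vertex lies on its carrier. [folklore] -/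
theorem mem_support_carrier (h : SmoothConeState deg I X g M 𝓗 E A B a b z) : z ∈ E.support := by
  obtain ⟨c, hreg, hc, hd, -, hE⟩ := h.vertex
  rw [mem_support_iff_stalkIdeal_le, hE, Ideal.span_singleton_le_iff_mem, ← hc]
  exact Ideal.subset_span ⟨0, rfl⟩

/-- The local ring at the vertex has dimension `4`. [folklore] -/
theorem ringKrullDim_stalk (h : SmoothConeState deg I X g M 𝓗 E A B a b z) : ringKrullDim (X.presheaf.stalk z) = (4 : ℕ) := by
  obtain ⟨c, hreg, hc, hd, -, -⟩ := h.vertex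
  rw [← IsRegularLocalRing.spanFinrank_maximalIdeal, hd]

/-- The vertex is not the whole space. [folklore] -/
theorem singleton_ne_univ (h : SmoothConeState deg I X g M 𝓗 E A B a b z) : ({z} : Set X) ≠ Set.univ := by
  haveI := h.isIntegral
  intro huniv
  have hη : genericPoint X = z := by
    have := Set.eq_univ_iff_forall.mp huniv (genericPoint X)
    simpa using this
  obtain ⟨c, hreg, hc, hd, -, -⟩ := h.vertex
  have hfield : IsField (X.presheaf.stalk z) := by
    rw [← hη]; exact (inferInstance : Field X.functionField).toIsField
  have hbot : maximalIdeal (X.presheaf.stalk z) = ⊥ := (IsLocalRing.isField_iff_maximalIdeal_eq.mp hfield)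
  rw [hbot, Submodule.spanFinrank_bot] at hd
  exact absurd hd (by norm_num)

/-- **Forgetting the host data**: a smooth-cone state at exponent `b = 0` is a cone-ladder END configuration — the conclusion of
the blow-up-form core holds for every `T = Bl_I Spec S` (the END `coneEnd` reads only the format, the carriers and the simple
normal crossings off the vertex, which is off the cosupport at `b = 0`). [cite: Kollar2007, (3.111) Step 3] [cite: StacksProject, Tag 080A] -/
theorem conclusion_of_zero (h : SmoothConeState deg I X g M 𝓗 E A B a 0 z) (hI : I ≠ ⊥)
    (hIm : ((affineBlowup.idealSheaf I).support : Set (Spec (.of S))) ⊆ {IsLocalRing.closedPoint S})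
    (T : Scheme.{u}) (f : T ⟶ Spec (.of S)) (hf : IsBlowup f (affineBlowup.idealSheaf I)) :
    ∃ (J : T.IdealSheafData) (T' : Scheme.{u}) (π : T' ⟶ T), J ≠ ⊥ ∧
      (∀ t : T, t ∈ J.support → f.base t = IsLocalRing.closedPoint S) ∧
      IsBlowup π J ∧ Scheme.IsRegular T' := by
  haveI := h.isNoetherian
  have hK : 𝓗 * monomialIdeal (A ++ [(E, a)]) ⊔ monomialIdeal (B ++ [(E, 0)]) =
      monomialIdeal ((𝓗, 1) :: (A ++ [(E, a)])) ⊔ monomialIdeal ((𝓗, 0) :: (B ++ [(E, 0)])) := by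
    rw [monomialIdeal_cons, monomialIdeal_cons, pow_one, pow_zero, Scheme.IdealSheafData.one_eq_top,
      Scheme.IdealSheafData.top_mul]
  have hfmt := h.format
  rw [hK] at hfmt
  refine coneEnd hI h.isRegular h.exists_isBlowup h.isLocallyPrincipal _ _ ?_ ?_ ?_ hfmt T f hf
  · show 𝓗 :: boundaryOf (A ++ [(E, a)]) = 𝓗 :: boundaryOf (B ++ [(E, 0)])
    rw [boundaryOf_append, boundaryOf_append, h.boundaryOf_eq]
    rfl
  · intro x hx
    have hxI : x ∈ ((affineBlowup.idealSheaf I).comap g).support := by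
      rw [hfmt, Scheme.IdealSheafData.support_mul]
      exact Or.inr hx
    have hgx : g x = IsLocalRing.closedPoint S := by
      rw [Scheme.IdealSheafData.support_comap] at hxI
      exact hIm hxI
    have hxz : x ≠ z := by
      rintro rfl
      rw [← hK] at hx
      have hB : stalkIdeal (monomialIdeal (B ++ [(E, 0)])) x = ⊤ := by
        rw [stalkIdeal_monomialIdeal, List.map_append, List.prod_append, List.map_singleton, List.prod_singleton,
          pow_zero, mul_one, ← Ideal.one_eq_top]
        refine List.prod_eq_one fun J hJ => ?_
        obtain ⟨p, hp, rfl⟩ := List.mem_map.mp hJ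
        have hD : x ∉ p.1.support := h.not_mem_support p.1 (h.boundaryOf_eq ▸ fst_mem_boundaryOf hp)
        rw [stalkIdeal_eq_top_of_not_mem_support hD, Ideal.top_pow, Ideal.one_eq_top]
      rw [mem_support_iff_stalkIdeal_ne_top, stalkIdeal_sup, hB] at hx
      exact hx (sup_top_eq _)
    have := h.snc x hgx hxz
    show DepthSNC.SNCWithAt (𝓗 :: boundaryOf (A ++ [(E, a)])) ⊤ x
    rwa [boundaryOf_append]
  · intro x hx
    have hxI : x ∈ ((affineBlowup.idealSheaf I).comap g).support := by
      rw [hfmt, Scheme.IdealSheafData.support_mul]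
      exact Or.inr hx
    rw [Scheme.IdealSheafData.support_comap] at hxI
    exact hIm hxI

end SmoothConeState

/-- The format algebra of one rung step with weight `d`, in any commutative semiring. [folklore] -/
theorem step_algebra_deg {R : Type*} [CommSemiring R] (M H P Q En Et : R) {d a b m k₁ k₂ : ℕ}
    (ha : a + d = m + k₁) (hb : b = m + k₂) :
    M * (En ^ d * H * (P * (En * Et) ^ a) + Q * (En * Et) ^ b) =
      M * En ^ m * (H * (P * Et ^ a * En ^ k₁) + Q * Et ^ b * En ^ k₂) := by
  have h1 : En ^ d * (En * Et) ^ a = En ^ m * En ^ k₁ * Et ^ a := by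
    rw [mul_pow, ← mul_assoc, ← pow_add, show d + a = m + k₁ by omega, pow_add]
  have h2 : (En * Et) ^ b = En ^ m * En ^ k₂ * Et ^ b := by
    rw [mul_pow, hb, pow_add]
  calc M * (En ^ d * H * (P * (En * Et) ^ a) + Q * (En * Et) ^ b)
      = M * (H * P * (En ^ d * (En * Et) ^ a) + Q * (En * Et) ^ b) := by ring
    _ = M * (H * P * (En ^ m * En ^ k₁ * Et ^ a) + Q * (En ^ m * En ^ k₂ * Et ^ b)) := by rw [h1, h2]
    _ = M * En ^ m * (H * (P * Et ^ a * En ^ k₁) + Q * Et ^ b * En ^ k₂) := by ring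

namespace SmoothConeState

variable {S : Type u} [CommRing S] [IsRegularLocalRing S] {deg : ℕ} {I : Ideal S} {X : Scheme.{u}} {g : X ⟶ Spec (.of S)}
  {M 𝓗 E : X.IdealSheafData} {A B : List (X.IdealSheafData × ℕ)} {a b : ℕ} {z : X}

/-- **ONE RUNG: blowing up the vertex (weight `d`).**  Given a smooth-cone state at the vertex `z` (exponents `a`, `b`) and a
blowing up `σ : X' ⟶ X` of the reduced point `z`, the transformed data form a state on `X'` at the new vertex `z'` provided by the
SMOOTH-CONE VERTEX FIBRE THEOREM: `g' = σ ≫ g`, `M' = σ^*M · 𝓘_{E'}^m` (`m = min (a+d) b`), host `σᶜ(𝓗, d)`, carriers the pull-backs of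
the old ones and `σᶜ(E, 1)` (exponents `a`, `b`), new vertex carrier `E'` with exponents `(a + d - m, b - m)`.
[cite: Kollar2007, 3.61 and (3.111) Step 3] [cite: Liu2002, Thm. 8.1.19 (a)] [cite: StacksProject, Tag 080B] -/
theorem step (h : SmoothConeState deg I X g M 𝓗 E A B a b z) {X' : Scheme.{u}} {σ : X' ⟶ X}
    (hσ : IsBlowup σ (vanishingIdeal (⟨{z}, h.isClosed⟩ : Closeds X))) :
    ∃ z' : X', SmoothConeState deg I X' (σ ≫ g)
      (M.comap σ * (vanishingIdeal (⟨{z}, h.isClosed⟩ : Closeds X)).comap σ ^ min (a + deg) b)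
      (controlledTransform σ (vanishingIdeal (⟨{z}, h.isClosed⟩ : Closeds X)) 𝓗 deg)
      ((vanishingIdeal (⟨{z}, h.isClosed⟩ : Closeds X)).comap σ)
      (comapExp A σ ++ [(controlledTransform σ (vanishingIdeal (⟨{z}, h.isClosed⟩ : Closeds X)) E 1, a)])
      (comapExp B σ ++ [(controlledTransform σ (vanishingIdeal (⟨{z}, h.isClosed⟩ : Closeds X)) E 1, b)])
      (a + deg - min (a + deg) b) (b - min (a + deg) b) z' := by
  classical
  set J : X.IdealSheafData := vanishingIdeal (⟨{z}, h.isClosed⟩ : Closeds X) with hJdef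
  set En : X'.IdealSheafData := J.comap σ with hEn
  set 𝓗' : X'.IdealSheafData := controlledTransform σ J 𝓗 deg with h𝓗'
  set Et : X'.IdealSheafData := controlledTransform σ J E 1 with hEt
  set m : ℕ := min (a + deg) b with hm
  haveI := h.isIntegral
  haveI := h.isNoetherian
  haveI : IsProper σ := hσ.isProper
  haveI : IsLocallyNoetherian X' := LocallyOfFiniteType.isLocallyNoetherian σ
  have hsuppJ : ∀ x : X, x ∈ J.support ↔ x = z := mem_support_vanishingIdeal_singleton_iff h.isClosed
  have hhost := h.stalkIdeal_host_le_pow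
  obtain ⟨c, hreg, hc, hd, ⟨N, hN, hV, hC, h𝓗z⟩, hEz⟩ := h.vertex
  -- THE SMOOTH-CONE VERTEX FIBRE THEOREM
  obtain ⟨z', hσz', ⟨c', hreg', hc', hd', hEn', ⟨N', hN', hV', hC', h𝓗'z⟩, hEt'⟩, hsnc'⟩ :=
    smoothCone_vertex_fibre hσ z c hc hd (stalkIdeal_vanishingIdeal_singleton h.isClosed) deg N hN hV hC 𝓗 E h𝓗z hEz
  -- the two transform identities
  have hH : En ^ deg * 𝓗' = 𝓗.comap σ := by
    refine pow_mul_controlledTransform_eq σ J hσ.isEffectiveCartier ?_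
    rw [← comap_pow]
    exact Scheme.IdealSheafData.comap_mono σ (le_vanishingIdeal_singleton_pow h.isClosed 𝓗 deg hhost)
  have hE : En ^ 1 * Et = E.comap σ := by
    refine pow_mul_controlledTransform_eq σ J hσ.isEffectiveCartier ?_
    rw [← comap_pow]
    refine Scheme.IdealSheafData.comap_mono σ (le_vanishingIdeal_singleton_pow h.isClosed E 1 ?_)
    rw [hEz, pow_one, Ideal.span_singleton_le_iff_mem, ← hc]
    exact Ideal.subset_span ⟨0, rfl⟩
  rw [pow_one] at hE
  refine ⟨z', ?_⟩
  have hz'cl : IsClosed ({z'} : Set X') := by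
    refine hσ.isClosed_singleton_of_ringKrullDim_eq (x' := z') (by rw [hσz']; exact h.isClosed) ?_
    rw [hσz', h.ringKrullDim_stalk, ← IsRegularLocalRing.spanFinrank_maximalIdeal, hd']
  refine
    { two_le := h.two_le
      isIntegral := hσ.isIntegral (vanishingIdeal_singleton_ne_bot h.isClosed h.singleton_ne_univ)
      isNoetherian := ?_
      isRegular := IsBlowup.isRegular_of_isRegular_subscheme h.isRegular
        (isRegular_subscheme_vanishingIdeal_singleton h.isClosed) hσ
      exists_isBlowup := ?_
      isLocallyPrincipal := (h.isLocallyPrincipal.comap σ).mul (hσ.isEffectiveCartier.isLocallyPrincipal.pow _)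
      boundaryOf_eq := by
        rw [boundaryOf_append, boundaryOf_append, boundaryOf_comapExp, boundaryOf_comapExp, h.boundaryOf_eq]; rfl
      format := ?_
      isClosed := hz'cl
      apply_eq := by rw [Scheme.Hom.comp_apply, hσz', h.apply_eq]
      vertex := ⟨c', hreg', hc', hd', ⟨N', hN', hV', hC', h𝓗'z⟩, hEn'⟩
      not_mem_support := ?_
      snc := ?_ }
  · haveI : CompactSpace X' := QuasiCompact.compactSpace_of_compactSpace σ
    exact {}
  · obtain ⟨K₀, hg, hK₀⟩ := h.exists_isBlowup
    exact IsBlowup.exists_isBlowup_comp_supported g K₀ σ J {IsLocalRing.closedPoint S} hg hK₀ hσ fun x hx => by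
      rw [(hsuppJ x).mp hx]; exact h.apply_eq
  · -- THE FORMAT
    have ha : a + deg = m + (a + deg - m) := by omega
    have hb : b = m + (b - m) := by omega
    rw [Scheme.IdealSheafData.comap_comp, h.format, comap_mul, Scheme.IdealSheafData.comap_sup, comap_mul,
      ← monomialIdeal_comapExp, ← monomialIdeal_comapExp]
    simp only [comapExp_append, comapExp_cons, comapExp_nil, monomialIdeal_append, monomialIdeal_singleton]
    rw [← hH, ← hE, ← Scheme.IdealSheafData.add_eq_sup, ← Scheme.IdealSheafData.add_eq_sup]
    exact step_algebra_deg (M.comap σ) 𝓗' (monomialIdeal (comapExp A σ)) (monomialIdeal (comapExp B σ)) En Et ha hb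
  · -- the other carriers miss the new vertex
    intro D hD
    rw [boundaryOf_append, boundaryOf_comapExp, show boundaryOf [(Et, a)] = [Et] from rfl] at hD
    rcases List.mem_append.mp hD with hD | hD
    · obtain ⟨D₀, hD₀, rfl⟩ := List.mem_map.mp hD
      rw [mem_support_comap_iff_apply, hσz']
      exact h.not_mem_support D₀ hD₀
    · rw [List.mem_singleton] at hD
      subst hD
      rw [mem_support_iff_stalkIdeal_ne_top, hEt']
      exact fun hne => hne rfl
  · -- simple normal crossings over the closed point off the new vertex
    intro x' hgx' hne
    rw [boundaryOf_append, boundaryOf_comapExp, show boundaryOf [(Et, a)] = [Et] from rfl]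
    have hcases : ∀ D ∈ 𝓗' :: (((boundaryOf A).map fun K => K.comap σ) ++ [Et] ++ [En]),
        D = 𝓗' ∨ (∃ D₀ ∈ boundaryOf A, D = D₀.comap σ) ∨ D = Et ∨ D = En := by
      intro D hD
      rcases List.mem_cons.mp hD with rfl | hD
      · exact Or.inl rfl
      rcases List.mem_append.mp hD with hD | hD
      · rcases List.mem_append.mp hD with hD | hD
        · obtain ⟨D₀, hD₀, rfl⟩ := List.mem_map.mp hD
          exact Or.inr (Or.inl ⟨D₀, hD₀, rfl⟩)
        · exact Or.inr (Or.inr (Or.inl (List.mem_singleton.mp hD)))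
      · exact Or.inr (Or.inr (Or.inr (List.mem_singleton.mp hD)))
    by_cases hx : σ x' = z
    · refine (hsnc' x' hx hne).anti fun D hD hxD => ?_
      rcases hcases D hD with rfl | ⟨D₀, hD₀, rfl⟩ | rfl | rfl
      · exact List.mem_cons_self
      · exfalso
        rw [mem_support_comap_iff_apply, hx] at hxD
        exact h.not_mem_support D₀ hD₀ hxD
      · exact List.mem_cons_of_mem _ (List.mem_cons_of_mem _ (List.mem_singleton_self _))
      · exact List.mem_cons_of_mem _ List.mem_cons_self
    · have hxJ : σ x' ∉ J.support := fun hmem => hx ((hsuppJ _).mp hmem)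
      haveI := hσ.isIso_stalkMap_of_not_mem_support hxJ
      have hgx : g (σ x') = IsLocalRing.closedPoint S := by rwa [Scheme.Hom.comp_apply] at hgx'
      have hold := h.snc (σ x') hgx hx
      let τ : X.IdealSheafData → X'.IdealSheafData := fun D =>
        if D = E then Et else if D = 𝓗 then 𝓗' else D.comap σ
      have hτE : τ E = Et := by simp only [τ, if_pos rfl]
      have hτH : τ 𝓗 = 𝓗' := by
        show (if 𝓗 = E then Et else if 𝓗 = 𝓗 then 𝓗' else 𝓗.comap σ) = 𝓗'
        rw [if_neg h.host_ne_carrier, if_pos rfl]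
      have hτD : ∀ D ∈ boundaryOf A, τ D = D.comap σ := by
        intro D hD
        have h1 : D ≠ E := fun heq => h.not_mem_support D hD (heq ▸ h.mem_support_carrier)
        have h2 : D ≠ 𝓗 := fun heq => h.not_mem_support D hD (heq ▸ h.mem_support_host)
        simp only [τ, if_neg h1, if_neg h2]
      have key := sncWithAt_map_of_isIso x' hold τ ?_ [En] ?_
      · refine key.anti fun D hD _ => ?_
        rcases hcases D hD with rfl | ⟨D₀, hD₀, rfl⟩ | rfl | rfl
        · rw [← hτH]
          exact List.mem_append_left _ (List.mem_map_of_mem List.mem_cons_self)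
        · rw [← hτD D₀ hD₀]
          exact List.mem_append_left _ (List.mem_map_of_mem (List.mem_cons_of_mem _ (List.mem_append_left _ hD₀)))
        · rw [← hτE]
          exact List.mem_append_left _
            (List.mem_map_of_mem (List.mem_cons_of_mem _ (List.mem_append_right _ (List.mem_singleton_self _))))
        · exact List.mem_append_right _ (List.mem_singleton_self _)
      · intro D hD _
        by_cases hDE : D = E
        · subst hDE
          rw [hτE]
          exact stalkIdeal_controlledTransform_of_not_mem_support _ 1 hxJ
        · by_cases hDH : D = 𝓗
          · subst hDH
            rw [hτH]
            exact stalkIdeal_controlledTransform_of_not_mem_support _ deg hxJ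
          · simp only [τ, if_neg hDE, if_neg hDH]
            exact stalkIdeal_comap_eq_map_stalkMap σ D x'
      · intro D hD
        rw [List.mem_singleton] at hD
        subst hD
        rw [mem_support_comap_iff_apply]
        exact hxJ

end SmoothConeState

end ConeDepth

end Summit.ResolutionOfSingularities.ResolutionOfSingularities.Theorems

end
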